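import Mathlib
import Summits.Ventures.HodgeRepro.Tier4.Target
import Summits.Ventures.HodgeRepro.Tier4.Line3.Defs
import Summits.Ventures.HodgeRepro.Tier4.Line3.DefsLemmas
import Summits.Ventures.HodgeRepro.Tier4.Line3.LocaliserS
import Summits.Ventures.HodgeRepro.Tier4.Line3.HasLocaliser
import Summits.Ventures.HodgeRepro.Tier4.Line3.HeckeEquivarianceLemmas
import Summits.Ventures.HodgeRepro.Tier4.Line3.TorusInvariance
import Summits.Ventures.HodgeRepro.Tier4.Line3.CoefMajorantWitness
import Summits.Ventures.HodgeRepro.Tier4.Line3.LocSScalarObstruction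

/-!
# Tier4/Line3/LocSScalarObstructionGen — `LocS` is empty for data scalar-symmetric UP TO CONSTANTS (the genuine archimedean shape)

Blind re-derivation cell `pub-hodge-repro`, Tier 4 «PROVE THE STEP», LINE L3, seat t4-L3-p2 (g2); follow-up of
`Tier4/Line3/LocSScalarObstruction.lean` (p678719).  The genuine slot functions satisfy the scalar symmetry only up to a non-zero
CONSTANT per slot: at a definite embedding `σ` the archimedean datum is `P_σ(x) e^{−π H_σ(x,x)}` with `P_σ` of bidegree `(a_σ, b_σ)`,
so `x ↦ u • x` multiplies it by `σ(u)^{a_σ} \overline{σ(u)}^{b_σ}` times the `gaussDef` ratio (paper note §3).  This module proves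
the obstruction in that generality:

* `isEmpty_locS_of_coefQ_ne_zero` — the core: whenever every Hecke combination normalised at `xm` has a non-zero coefficient at
  the tuple `x′` obtained from `xm` by scaling ONE slot `j` by `u` (`c(u) u ≠ 1`, `xm j ≠ 0`), `LocS D p L₀ xm` is empty (the proof
  of p678719's main theorem with its first step abstracted and the slot made arbitrary);
* `SlotScalarSymmetric D j u lam := ∀ x, cf j (u • x) · gaussDef x = lam · (cf j x · gaussDef (u • x))` — the symmetry of ONE slot
  function; every Hecke translate inherits it (`heckeAct_smul_of_slotScalarSymmetric`), the quadruple coefficient picks up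
  `slotConst j lam` (`lam` on slots `0, 1`, `conj lam` on `2, 3`; `coefQ_slot_of_slotScalarSymmetric`), hence
  **`isEmpty_locS_of_slotScalarSymmetric`**: the symmetry of a SINGLE slot function for a single scalar with `c(u) u ≠ 1` empties
  `LocS` around every `xm` with `xm j ≠ 0` — the per-slot form of the obstruction (x2 S13421 (2), crit-2 S13431 (a));
* `ScalarSymmetricUpTo D u lam` (all four slots, constants `lam j ≠ 0`) ⇒ `isEmpty_locS_of_scalarSymmetricUpTo`,
  `not_hasLocaliser_of_scalarSymmetricUpTo`; the landed `ScalarSymmetric` is the case `lam = 1`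
  (`scalarSymmetricUpTo_of_scalarSymmetric`).

Nothing here says anything about the status of the Hodge conjecture for CM abelian varieties, which is NOT proved
(HC_CM is NOT proved by anyone in this repository).
-/

set_option autoImplicit false

noncomputable section

namespace Summit.Ventures.HodgeRepro.Tier4.Line3

open Summit.Ventures.HodgeRepro.Tier4
open Matrix NumberField
open scoped ComplexConjugate

namespace T4Data

variable (X : T4Data)

/-- **THE CORE OBSTRUCTION.**  Let `x′` be `xm` with slot `j` scaled by `u` (`x′ j = u • xm j`, `xm j ≠ 0`, `c(u) u ≠ 1`).  If every
Hecke combination of every level that is normalised at `xm` has a non-zero coefficient at `x′`, then `LocS D p L₀ xm` is empty: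
`supp` would put `x′` into the depth-`N` ball up to the norm-one torus at every depth, which Krull's intersection theorem forbids. -/
theorem isEmpty_locS_of_coefQ_ne_zero (D : X.ThetaData) {u : X.E} (hN : X.c u * u ≠ 1)
    (p : IsDedekindDomain.HeightOneSpectrum (RingOfIntegers X.E))
    (L₀ : Submodule (RingOfIntegers X.E) (Fin 3 → X.E)) (xm : X.Tuple) (j : Fin 4) (hxm : xm j ≠ 0)
    (x' : X.Tuple) (hx'j : x' j = u • xm j)
    (hne : ∀ (K : X.Level) (γ : X.Tr K), X.coefQ D.cf γ xm = 1 → X.coefQ D.cf γ x' ≠ 0) :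
    IsEmpty (X.LocS D p L₀ xm) := by
  refine ⟨fun ℓ => ?_⟩
  obtain ⟨S, hS, hsupp⟩ := ℓ.supp
  obtain ⟨i, hi⟩ : ∃ i, xm j i ≠ 0 := by
    by_contra hcon
    exact hxm (funext fun i => not_not.1 (not_exists.1 hcon i))
  obtain ⟨d, hd0, hdS, m', hm'⟩ := X.exists_common_denominator S (fun L hL => (hS L hL).1.1) i (xm j i)
  have hm'0 : algebraMap _ X.E m' ≠ 0 := by
    rw [hm', Algebra.smul_def]
    exact mul_ne_zero ((IsFractionRing.injective (RingOfIntegers X.E) X.E).ne_iff' (map_zero _) |>.2 hd0) hi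
  set 𝔮 : Ideal (RingOfIntegers X.E) := p.asIdeal * X.conjIdeal p.asIdeal with h𝔮
  have h𝔮top : 𝔮 ≠ ⊤ := X.mul_conjIdeal_ne_top p
  have hσ𝔮 : Ideal.map X.conjO 𝔮 = 𝔮 := X.map_conjO_mul_conjIdeal p.asIdeal
  have hstep : ∀ N : ℕ, ∃ (T : X.E) (q : RingOfIntegers X.E), X.c T * T = 1 ∧ q ∈ 𝔮 ^ N ∧
      algebraMap _ X.E q = (T * u - 1) * algebraMap _ X.E m' := by
    intro N
    have hne' : X.coefQ D.cf (ℓ.loc N) (X.rep (X.lines x')) ≠ 0 := by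
      intro h0
      obtain ⟨t, ht, hrep⟩ := X.exists_torus_of_lines_eq (X.lines_rep (X.lines x'))
      have heq : x' = fun k => t k • X.rep (X.lines x') k := funext fun k => hrep k
      refine hne (ℓ.level N) (ℓ.loc N) (ℓ.main_one N) ?_
      rw [heq, X.coefQ_smul D.cf D.weight (ℓ.loc N) t ht, h0]
    obtain ⟨x, hx, L, hL, hxL⟩ := hsupp N _ hne'
    obtain ⟨t, ht, hxt⟩ := X.exists_torus_of_lines_eq hx.symm
    have hx0 : x j = t j • (u • xm j) := by rw [hxt j, hx'j]
    have h0 : (t j * u - 1) • xm j ∈ 𝔮 ^ N • L := by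
      have e : x j - xm j = (t j * u - 1) • xm j := by rw [hx0, smul_smul, sub_smul, one_smul]
      exact e ▸ hxL j
    have h1 : (t j * u - 1) * xm j i ∈
        𝔮 ^ N • L.map (LinearMap.proj i : (Fin 3 → X.E) →ₗ[RingOfIntegers X.E] X.E) := by
      have := Submodule.mem_map_of_mem
        (f := (LinearMap.proj i : (Fin 3 → X.E) →ₗ[RingOfIntegers X.E] X.E)) h0
      rw [Submodule.map_smul''] at this
      simpa only [LinearMap.proj_apply, Pi.smul_apply, smul_eq_mul] using this
    obtain ⟨q, hq, hq'⟩ := exists_mem_of_mem_smul (𝔮 ^ N) _ d (hdS L hL) h1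
    refine ⟨t j, q, ht j, hq, ?_⟩
    rw [hq', hm', Algebra.smul_def, Algebra.smul_def]
    ring
  choose T q hT hq hq' using hstep
  have hzval : ∀ N, algebraMap _ X.E (q N * X.conjO (q N) + q N * X.conjO m' + X.conjO (q N) * m') =
      algebraMap _ X.E (m' * X.conjO m') * (X.c u * u - 1) := by
    intro N
    simp only [map_add, map_mul, X.coe_conjO]
    exact key_identity X.c u (T N) _ _ (hT N) (hq' N)
  have hzmem : ∀ N, q N * X.conjO (q N) + q N * X.conjO m' + X.conjO (q N) * m' ∈ 𝔮 ^ N := by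
    intro N
    have hσq : X.conjO (q N) ∈ 𝔮 ^ N := by
      simpa only [Ideal.map_pow, hσ𝔮] using Ideal.mem_map_of_mem X.conjO (hq N)
    exact (𝔮 ^ N).add_mem ((𝔮 ^ N).add_mem ((𝔮 ^ N).mul_mem_right _ (hq N)) ((𝔮 ^ N).mul_mem_right _ (hq N)))
      ((𝔮 ^ N).mul_mem_right _ hσq)
  have hzeq : ∀ N, q N * X.conjO (q N) + q N * X.conjO m' + X.conjO (q N) * m' =
      q 0 * X.conjO (q 0) + q 0 * X.conjO m' + X.conjO (q 0) * m' := fun N =>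
    RingOfIntegers.ext ((hzval N).trans (hzval 0).symm)
  have hz0 : q 0 * X.conjO (q 0) + q 0 * X.conjO m' + X.conjO (q 0) * m' = 0 :=
    eq_zero_of_forall_mem_pow h𝔮top fun N => hzeq N ▸ hzmem N
  have hfinal := hzval 0
  rw [hz0, map_zero] at hfinal
  have hne'' : algebraMap _ X.E (m' * X.conjO m') ≠ 0 := by
    rw [map_mul, X.coe_conjO]
    exact mul_ne_zero hm'0 ((map_ne_zero_iff X.c X.c.injective).2 hm'0)
  exact hN (sub_eq_zero.1 ((mul_eq_zero.1 hfinal.symm).resolve_left hne''))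

/-! ### Scalar symmetry at ONE slot -/

/-- **SCALAR SYMMETRY OF ONE SLOT FUNCTION UP TO A CONSTANT**: `cf j (u • x) · gaussDef x = lam · (cf j x · gaussDef (u • x))`. -/
def SlotScalarSymmetric (D : X.ThetaData) (j : Fin 4) (u : X.E) (lam : ℂ) : Prop :=
  ∀ x : Fin 3 → X.E, D.cf j (u • x) * (X.gaussDef x : ℂ) = lam * (D.cf j x * (X.gaussDef (u • x) : ℂ))

/-- Every Hecke translate of every level of the slot function inherits the symmetry with the same constant. -/
theorem heckeAct_smul_of_slotScalarSymmetric (D : X.ThetaData) {j : Fin 4} {u : X.E} {lam : ℂ}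
    (hu : X.SlotScalarSymmetric D j u lam) (K : X.Level) {h : HeckeElement X.E} (hh : h.IsFor X.c X.H K.1)
    (x : Fin 3 → X.E) :
    X.heckeAct h (D.cf j) (u • x) * (X.gaussDef x : ℂ) = lam * (X.heckeAct h (D.cf j) x * (X.gaussDef (u • x) : ℂ)) := by
  unfold T4Data.heckeAct
  rw [← List.sum_map_mul_right, ← List.sum_map_mul_right, ← List.sum_map_mul_left]
  congr 1
  refine List.map_congr_left fun t ht => ?_
  rw [smul_mul_assoc, smul_mul_assoc, Finset.sum_mul, Finset.sum_mul, mul_smul_comm, Finset.mul_sum]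
  congr 1
  refine Finset.sum_congr rfl fun r hr => ?_
  have hru : IsUnitaryOf X.c X.H r := HeckeEquivariance.isUnitaryOf_of_isFor X K hh ht hr
  rw [Matrix.mulVec_smul, ← X.gaussDef_mulVec_of_unitary hru x, hu, ← Matrix.mulVec_smul,
    X.gaussDef_mulVec_of_unitary hru]

/-- The constant carried by slot `j` in the quadruple coefficient: `lam` on slots `0, 1`, `conj lam` on slots `2, 3`. -/
def slotConst (j : Fin 4) (lam : ℂ) : ℂ := if (j : ℕ) < 2 then lam else conj lam

/-- `slotConst j lam ≠ 0` when `lam ≠ 0`. -/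
theorem slotConst_ne_zero {j : Fin 4} {lam : ℂ} (h : lam ≠ 0) : slotConst j lam ≠ 0 := by
  unfold slotConst
  split_ifs
  · exact h
  · exact (map_ne_zero_iff _ (RingHom.injective _)).2 h

/-- Transport along a slot-`0` identity. -/
theorem quad_slot0 {a A A' A1 A2 A3 lam : ℂ} {g g' : ℝ} (h : A' * g = lam * (A * g')) :
    a * (A' * A1) * conj (A2 * A3) * g = lam * (a * (A * A1) * conj (A2 * A3) * g') := by
  linear_combination (a * A1 * conj (A2 * A3)) * h

/-- Transport along a slot-`1` identity. -/
theorem quad_slot1 {a A A' A0 A2 A3 lam : ℂ} {g g' : ℝ} (h : A' * g = lam * (A * g')) :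
    a * (A0 * A') * conj (A2 * A3) * g = lam * (a * (A0 * A) * conj (A2 * A3) * g') := by
  linear_combination (a * A0 * conj (A2 * A3)) * h

/-- Transport along a slot-`2` identity (through `conj`). -/
theorem quad_slot2 {a A A' A0 A1 A3 lam : ℂ} {g g' : ℝ} (h : A' * g = lam * (A * g')) :
    a * (A0 * A1) * conj (A' * A3) * g = conj lam * (a * (A0 * A1) * conj (A * A3) * g') := by
  have hc : conj A' * (g : ℂ) = conj lam * (conj A * (g' : ℂ)) := by
    simpa only [map_mul, Complex.conj_ofReal] using congrArg conj h
  rw [map_mul, map_mul]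
  linear_combination (a * A0 * A1 * conj A3) * hc

/-- Transport along a slot-`3` identity (through `conj`). -/
theorem quad_slot3 {a A A' A0 A1 A2 lam : ℂ} {g g' : ℝ} (h : A' * g = lam * (A * g')) :
    a * (A0 * A1) * conj (A2 * A') * g = conj lam * (a * (A0 * A1) * conj (A2 * A) * g') := by
  have hc : conj A' * (g : ℂ) = conj lam * (conj A * (g' : ℂ)) := by
    simpa only [map_mul, Complex.conj_ofReal] using congrArg conj h
  rw [map_mul, map_mul]
  linear_combination (a * A0 * A1 * conj A2) * hc

/-- `slotConst 0 lam = lam`. -/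
theorem slotConst_zero (lam : ℂ) : slotConst 0 lam = lam := if_pos (by decide)
/-- `slotConst 1 lam = lam`. -/
theorem slotConst_one (lam : ℂ) : slotConst 1 lam = lam := if_pos (by decide)
/-- `slotConst 2 lam = conj lam`. -/
theorem slotConst_two (lam : ℂ) : slotConst 2 lam = conj lam := if_neg (by decide)
/-- `slotConst 3 lam = conj lam`. -/
theorem slotConst_three (lam : ℂ) : slotConst 3 lam = conj lam := if_neg (by decide)

/-- Scaling ONE slot of the tuple: the quadruple coefficient picks up `slotConst j lam`. -/
theorem coefQ_slot_of_slotScalarSymmetric (D : X.ThetaData) {j : Fin 4} {u : X.E} {lam : ℂ}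
    (hu : X.SlotScalarSymmetric D j u lam) {K : X.Level} (γ : X.Tr K) (x x' : X.Tuple) (hj : x' j = u • x j)
    (hk : ∀ k, k ≠ j → x' k = x k) :
    X.coefQ D.cf γ x' * (X.gaussDef (x j) : ℂ) = slotConst j lam * (X.coefQ D.cf γ x * (X.gaussDef (u • x j) : ℂ)) := by
  have hj4 : j = 0 ∨ j = 1 ∨ j = 2 ∨ j = 3 := by fin_cases j <;> simp
  rcases hj4 with rfl | rfl | rfl | rfl
  all_goals unfold T4Data.coefQ
  all_goals rw [Finsupp.sum_mul, Finsupp.sum_mul, Finsupp.mul_sum]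
  all_goals refine Finsupp.sum_congr fun h _ => ?_
  · rw [hj, hk 1 (by decide), hk 2 (by decide), hk 3 (by decide), slotConst_zero]
    exact quad_slot0 (X.heckeAct_smul_of_slotScalarSymmetric D hu K (h.2 (X.slot 0)) (x 0))
  · rw [hj, hk 0 (by decide), hk 2 (by decide), hk 3 (by decide), slotConst_one]
    exact quad_slot1 (X.heckeAct_smul_of_slotScalarSymmetric D hu K (h.2 (X.slot 1)) (x 1))
  · rw [hj, hk 0 (by decide), hk 1 (by decide), hk 3 (by decide), slotConst_two]
    exact quad_slot2 (X.heckeAct_smul_of_slotScalarSymmetric D hu K (h.2 (X.slot 2)) (x 2))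
  · rw [hj, hk 0 (by decide), hk 1 (by decide), hk 2 (by decide), slotConst_three]
    exact quad_slot3 (X.heckeAct_smul_of_slotScalarSymmetric D hu K (h.2 (X.slot 3)) (x 3))

/-- **`LocS` IS EMPTY AS SOON AS ONE SLOT FUNCTION IS SCALAR-SYMMETRIC** (up to a non-zero constant) for a scalar with
`c(u) u ≠ 1`, around every `xm` whose slot-`j` vector is non-zero. -/
theorem isEmpty_locS_of_slotScalarSymmetric (D : X.ThetaData) {j : Fin 4} {u : X.E} {lam : ℂ}
    (hu : X.SlotScalarSymmetric D j u lam) (hlam : lam ≠ 0) (hN : X.c u * u ≠ 1)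
    (p : IsDedekindDomain.HeightOneSpectrum (RingOfIntegers X.E))
    (L₀ : Submodule (RingOfIntegers X.E) (Fin 3 → X.E)) (xm : X.Tuple) (hxm : xm j ≠ 0) :
    IsEmpty (X.LocS D p L₀ xm) := by
  refine X.isEmpty_locS_of_coefQ_ne_zero D hN p L₀ xm j hxm (Function.update xm j (u • xm j))
    (Function.update_self j _ xm) fun K γ h1 h0 => ?_
  have h2 := X.coefQ_slot_of_slotScalarSymmetric D hu γ xm (Function.update xm j (u • xm j))
    (Function.update_self j _ xm) (fun k hk => Function.update_of_ne hk _ xm)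
  rw [h0, h1, zero_mul, one_mul] at h2
  exact mul_ne_zero (slotConst_ne_zero hlam) (Complex.ofReal_ne_zero.2 (X.gaussDef_pos (u • xm j)).ne') h2.symm

/-! ### Scalar symmetry of all four slots up to constants -/

/-- **SCALAR SYMMETRY UP TO A NON-ZERO CONSTANT PER SLOT** (`lam j`): `cf j (u • x) · gaussDef x = lam j · cf j x · gaussDef (u • x)`.
The shape of the genuine coefficient system for a unit `u ≡ 1` modulo the bad conductor, the constants being the archimedean
phases `σ(u)^{a_σ} \overline{σ(u)}^{b_σ}` of the definite places (paper note §3). -/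
def ScalarSymmetricUpTo (D : X.ThetaData) (u : X.E) (lam : Fin 4 → ℂ) : Prop :=
  ∀ (j : Fin 4) (x : Fin 3 → X.E),
    D.cf j (u • x) * (X.gaussDef x : ℂ) = lam j * (D.cf j x * (X.gaussDef (u • x) : ℂ))

/-- The landed `ScalarSymmetric` is the case `lam = 1`. -/
theorem scalarSymmetricUpTo_of_scalarSymmetric (D : X.ThetaData) {u : X.E} (hu : X.ScalarSymmetric D u) :
    X.ScalarSymmetricUpTo D u (fun _ => 1) := fun j x => by rw [hu j x, one_mul]

/-- Every Hecke translate of every level inherits the symmetry with the same constant. -/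
theorem heckeAct_smul_of_scalarSymmetricUpTo (D : X.ThetaData) {u : X.E} {lam : Fin 4 → ℂ}
    (hu : X.ScalarSymmetricUpTo D u lam) (K : X.Level) {h : HeckeElement X.E} (hh : h.IsFor X.c X.H K.1) (j : Fin 4)
    (x : Fin 3 → X.E) :
    X.heckeAct h (D.cf j) (u • x) * (X.gaussDef x : ℂ) = lam j * (X.heckeAct h (D.cf j) x * (X.gaussDef (u • x) : ℂ)) := by
  unfold T4Data.heckeAct
  rw [← List.sum_map_mul_right, ← List.sum_map_mul_right, ← List.sum_map_mul_left]
  congr 1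
  refine List.map_congr_left fun t ht => ?_
  rw [smul_mul_assoc, smul_mul_assoc, Finset.sum_mul, Finset.sum_mul, mul_smul_comm, Finset.mul_sum]
  congr 1
  refine Finset.sum_congr rfl fun r hr => ?_
  have hru : IsUnitaryOf X.c X.H r := HeckeEquivariance.isUnitaryOf_of_isFor X K hh ht hr
  rw [Matrix.mulVec_smul, ← X.gaussDef_mulVec_of_unitary hru x, hu j, ← Matrix.mulVec_smul,
    X.gaussDef_mulVec_of_unitary hru]

/-- Transport of a quadruple product along four slot identities with constants. -/
theorem quad_transport_lam {a A0 A1 A2 A3 B0 B1 B2 B3 l0 l1 l2 l3 : ℂ} {g0 g1 g2 g3 k0 k1 k2 k3 : ℝ}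
    (h0 : B0 * g0 = l0 * (A0 * k0)) (h1 : B1 * g1 = l1 * (A1 * k1)) (h2 : B2 * g2 = l2 * (A2 * k2))
    (h3 : B3 * g3 = l3 * (A3 * k3)) :
    a * (B0 * B1) * conj (B2 * B3) * ((g0 : ℂ) * g1 * g2 * g3) =
      l0 * l1 * conj (l2 * l3) * (a * (A0 * A1) * conj (A2 * A3) * ((k0 : ℂ) * k1 * k2 * k3)) := by
  have h2c : conj B2 * (g2 : ℂ) = conj l2 * (conj A2 * (k2 : ℂ)) := by
    simpa only [map_mul, Complex.conj_ofReal] using congrArg conj h2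
  have h3c : conj B3 * (g3 : ℂ) = conj l3 * (conj A3 * (k3 : ℂ)) := by
    simpa only [map_mul, Complex.conj_ofReal] using congrArg conj h3
  calc a * (B0 * B1) * conj (B2 * B3) * ((g0 : ℂ) * g1 * g2 * g3)
      = a * (B0 * g0) * (B1 * g1) * (conj B2 * g2) * (conj B3 * g3) := by rw [map_mul]; ring
    _ = a * (l0 * (A0 * k0)) * (l1 * (A1 * k1)) * (conj l2 * (conj A2 * k2)) * (conj l3 * (conj A3 * k3)) := by
          rw [h0, h1, h2c, h3c]
    _ = l0 * l1 * conj (l2 * l3) * (a * (A0 * A1) * conj (A2 * A3) * ((k0 : ℂ) * k1 * k2 * k3)) := by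
          rw [map_mul, map_mul]; ring

/-- The quadruple coefficient inherits the symmetry with the constant `lam 0 · lam 1 · conj (lam 2 · lam 3)`. -/
theorem coefQ_smul_of_scalarSymmetricUpTo (D : X.ThetaData) {u : X.E} {lam : Fin 4 → ℂ}
    (hu : X.ScalarSymmetricUpTo D u lam) {K : X.Level} (γ : X.Tr K) (x : X.Tuple) :
    X.coefQ D.cf γ (fun j => u • x j) * ∏ j, (X.gaussDef (x j) : ℂ) =
      lam 0 * lam 1 * conj (lam 2 * lam 3) * (X.coefQ D.cf γ x * ∏ j, (X.gaussDef (u • x j) : ℂ)) := by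
  unfold T4Data.coefQ
  rw [Finsupp.sum_mul, Finsupp.sum_mul, Finsupp.mul_sum]
  refine Finsupp.sum_congr fun h _ => ?_
  simp only [Fin.prod_univ_four]
  exact quad_transport_lam (X.heckeAct_smul_of_scalarSymmetricUpTo D hu K (h.2 (X.slot 0)) 0 (x 0))
    (X.heckeAct_smul_of_scalarSymmetricUpTo D hu K (h.2 (X.slot 1)) 1 (x 1))
    (X.heckeAct_smul_of_scalarSymmetricUpTo D hu K (h.2 (X.slot 2)) 2 (x 2))
    (X.heckeAct_smul_of_scalarSymmetricUpTo D hu K (h.2 (X.slot 3)) 3 (x 3))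

/-- Scalar symmetry of all four slots gives the symmetry of each slot. -/
theorem slotScalarSymmetric_of_scalarSymmetricUpTo (D : X.ThetaData) {u : X.E} {lam : Fin 4 → ℂ}
    (hu : X.ScalarSymmetricUpTo D u lam) (j : Fin 4) : X.SlotScalarSymmetric D j u (lam j) := fun x => hu j x

/-- **`LocS` IS EMPTY FOR DATA SCALAR-SYMMETRIC UP TO CONSTANTS.** -/
theorem isEmpty_locS_of_scalarSymmetricUpTo (D : X.ThetaData) {u : X.E} {lam : Fin 4 → ℂ}
    (hu : X.ScalarSymmetricUpTo D u lam) (hlam : ∀ j, lam j ≠ 0) (hN : X.c u * u ≠ 1)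
    (p : IsDedekindDomain.HeightOneSpectrum (RingOfIntegers X.E))
    (L₀ : Submodule (RingOfIntegers X.E) (Fin 3 → X.E)) (xm : X.Tuple) (hxm : xm 0 ≠ 0) :
    IsEmpty (X.LocS D p L₀ xm) :=
  X.isEmpty_locS_of_slotScalarSymmetric D (X.slotScalarSymmetric_of_scalarSymmetricUpTo D hu 0) (hlam 0) hN p L₀ xm hxm

/-- No printed localiser for data scalar-symmetric up to constants. -/
theorem not_hasLocaliser_of_scalarSymmetricUpTo (D : X.ThetaData) {u : X.E} {lam : Fin 4 → ℂ}
    (hu : X.ScalarSymmetricUpTo D u lam) (hlam : ∀ j, lam j ≠ 0) (hN : X.c u * u ≠ 1) : ¬ X.HasLocaliser D := by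
  rintro ⟨p, L₀, xm, -, -, -, -, hab, -, ⟨ℓ⟩⟩
  exact (X.isEmpty_locS_of_scalarSymmetricUpTo D hu hlam hN p L₀ xm (X.ne_zero_of_wedge hab)).false ℓ

end T4Data

end Summit.Ventures.HodgeRepro.Tier4.Line3

end
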